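import Summits.ValiantsHypothesis.ValiantsHypothesis.Theorems.GrenetZeonDualUnipotentThreeHalvesHeavyTopHalfSpeedPacking

/-!
# `GrenetZeon.DualUnipotentThreeHalves` (stmt-ValiantsHypothesis-24318), LINE β `half_speed`, K1 (iii) ASSEMBLY KIT — the two small
# dimension facts that connect ✓ `exists_block_conj` (port-4), ✓ `exists_halfSpeed_chain` (port-3 p664778) and the packing
# ✓ p664853 (`packing_height` / `packing_codim`)

(ii-ARITH)/pool hand val-port-2 g2 (first inheritor per desk #332; see `pub/val-lit/lmr/staged/port3g2-halfspeed/README.md`).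
* (orientation flip and «monotone coarsening keeps block shape» are ✓ p666077 `…HalfSpeedCoarsen` :: `blockTri_flip`, `flip_lt`,
  `blockTri_comp_monotone` — val-port-3 g2's last file; cited, not duplicated.)
* `finrank_matrix_submodule_le_card_sq` — KILL levels: `dim U_t ≤ (#level t)²` (the `u t ≤ (g t)²` input of `packing_codim`).
* `sum_card_level_eq_card` — `Σ_{t<L} #{i : μ i = t} = card ι` (the `Σ g = D` input of the packing lemmas).

Honest framing.  Bookkeeping (`--supports stmt-ValiantsHypothesis-24318 --as helper`); proves nothing about K1, `HalfSpeedIrrLaw`, R2, the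
crux, 8062 or `VP ≠ VNP` — all OPEN / NOT proved. [desk #332 inheritance; port-3 README (iii)]
-/

set_option linter.dupNamespace false
set_option autoImplicit false

namespace Summit.ValiantsHypothesis.ValiantsHypothesis.Theorems.GrenetZeon.HalfSpeed

open scoped BigOperators

variable {ι : Type*}

-- (orientation flip / monotone coarsening: see ✓ p666077 `…HeavyTopHalfSpeedCoarsen` — `blockTri_flip`, `flip_lt`,
-- `blockTri_comp_monotone`; not duplicated here.)

/-- **Kill-level dimension.**  Any space of `κ × κ` matrices has dimension `≤ (card κ)²`. -/
theorem finrank_matrix_submodule_le_card_sq {κ : Type*} [Fintype κ] [DecidableEq κ]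
    (V : Submodule ℂ (Matrix κ κ ℂ)) : Module.finrank ℂ V ≤ Fintype.card κ ^ 2 := by
  have h := Submodule.finrank_le V
  have hM : Module.finrank ℂ (Matrix κ κ ℂ) = Fintype.card κ ^ 2 := by
    simp [Module.finrank_matrix, sq]
  omega

/-- **Level sizes partition the index type**: `Σ_{t<L} #{i : μ i = t} = card ι` when all levels are `< L`. -/
theorem sum_card_level_eq_card [Fintype ι] (L : ℕ) (μ : ι → ℕ) (hμ : ∀ i, μ i < L) :
    ∑ t ∈ Finset.range L, Fintype.card {i // μ i = t} = Fintype.card ι := by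
  classical
  have h := Finset.card_eq_sum_card_fiberwise (s := (Finset.univ : Finset ι)) (t := Finset.range L) (f := μ)
    (fun i _ => Finset.mem_range.2 (hμ i))
  rw [Finset.card_univ] at h
  rw [h]
  refine Finset.sum_congr rfl fun t _ => ?_
  rw [Fintype.card_subtype]

end Summit.ValiantsHypothesis.ValiantsHypothesis.Theorems.GrenetZeon.HalfSpeed
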